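import Summits.ValiantsHypothesis.ValiantsHypothesis.Theorems.BarrierLeverPartitionMinorsHitByVPProductStates

/-!
# Route BarrierLever — item `PartitionMinorsHitByVP` (stmt-ValiantsHypothesis-19717):
# PRINCIPAL-TYPE layouts (the columns are a rearrangement of the rows) are hit exactly, `b = 2`

Helper file (`--supports stmt-ValiantsHypothesis-19717`; cell valiant-natproofs, rung V4, 𝒟-side, prover seat
val-np-p3). Closes NO item. An UNCONDITIONAL structural class of item 19717, of every size `r ≤ 2^h`, by an EXACT
(non-generic, non-tropical) witness.

**Theorem (`partitionMinor_hit_of_principal`).** If the column family is a rearrangement of the row family,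
`w j = u (κ j)` for a permutation `κ` of `Fin r` (`u` injective, `h ≥ 1`), then the DIAGONAL PRODUCT STATE
`f = ∏_a (1 + x_a y_a) ∈ SmallCircuits ℂ (h+h) 2` has `coeff_{x^U y^W} f = [U = W]` (`coeff_diagState`), so the
layout matrix of item 19717 is the permutation matrix of `κ` and its determinant is `sign κ ≠ 0`.
This is the partition-matrix counterpart of the tree's CT statement for principal layouts
(`…ResultantKernel.resultantKernel_principal_layout_ne_zero`) and extends the full-matrix case
(`…StubPartitionDeterminantHit`, `r = 2^h`) to every principal-type minor, directly in `VP` with `b = 2`.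

WHAT THIS IS NOT: nothing for layouts whose column family differs from the row family (the content of item
19717); nothing on crux 14610.
-/

-- layout Summits/ValiantsHypothesis/ValiantsHypothesis forces the duplicated namespace component
set_option linter.dupNamespace false

namespace Summit.ValiantsHypothesis.ValiantsHypothesis.Theorems.BarrierLever.ProductStateSums

open Finset MvPolynomial Literature.Barriers.ValiantsHypothesis Literature.Computability.AlgebraicComplexity

noncomputable section

variable {h : ℕ}

/-- The `x_a`-exponent of the diagonal monomial `∏_{a ∈ S} x_a y_a`. -/
theorem diagExpo_apply_castAdd (S : Finset (Fin h)) (a : Fin h) :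
    (∑ a' ∈ S, (Finsupp.single (Fin.castAdd h a') 1 + Finsupp.single (Fin.natAdd h a') 1) :
      Fin (h + h) →₀ ℕ) (Fin.castAdd h a) = if a ∈ S then 1 else 0 := by
  rw [Finsupp.finsetSum_apply]
  simp only [Finsupp.add_apply, Finsupp.single_apply, Fin.castAdd_inj, (castAdd_ne_natAdd _ _).symm,
    if_false, add_zero]
  rw [Finset.sum_ite_eq' S a]

/-- The `y_c`-exponent of the diagonal monomial `∏_{a ∈ S} x_a y_a`. -/
theorem diagExpo_apply_natAdd (S : Finset (Fin h)) (c : Fin h) :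
    (∑ a' ∈ S, (Finsupp.single (Fin.castAdd h a') 1 + Finsupp.single (Fin.natAdd h a') 1) :
      Fin (h + h) →₀ ℕ) (Fin.natAdd h c) = if c ∈ S then 1 else 0 := by
  rw [Finsupp.finsetSum_apply]
  simp only [Finsupp.add_apply, Finsupp.single_apply, Fin.natAdd_inj, castAdd_ne_natAdd, if_false,
    zero_add]
  rw [Finset.sum_ite_eq' S c]

/-- The diagonal monomial of `S` is the partition monomial `x^U y^W` iff `S = U` and `S = W`. -/
theorem diagExpo_eq_partitionExpo_iff (S U W : Finset (Fin h)) :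
    (∑ a' ∈ S, (Finsupp.single (Fin.castAdd h a') 1 + Finsupp.single (Fin.natAdd h a') 1) :
      Fin (h + h) →₀ ℕ) =
      (∑ a' ∈ U, Finsupp.single (Fin.castAdd h a') 1 + ∑ c ∈ W, Finsupp.single (Fin.natAdd h c) 1)
    ↔ S = U ∧ S = W := by
  constructor
  · intro hS
    constructor
    · ext a
      have h1 := congrArg (fun v => v (Fin.castAdd h a)) hS
      simp only [diagExpo_apply_castAdd, partitionExpo_apply_castAdd] at h1
      by_cases ha : a ∈ S <;> by_cases hb : a ∈ U <;> simp_all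
    · ext c
      have h1 := congrArg (fun v => v (Fin.natAdd h c)) hS
      simp only [diagExpo_apply_natAdd, partitionExpo_apply_natAdd] at h1
      by_cases ha : c ∈ S <;> by_cases hb : c ∈ W <;> simp_all
  · rintro ⟨rfl, rfl⟩
    ext x
    refine Fin.addCases (fun a => ?_) (fun c => ?_) x
    · rw [diagExpo_apply_castAdd, partitionExpo_apply_castAdd]
    · rw [diagExpo_apply_natAdd, partitionExpo_apply_natAdd]

/-- The diagonal product state expanded: `∏_a (1 + x_a y_a) = Σ_S ∏_{a∈S} x_a y_a`. -/
theorem diagState_eq_sum_monomial :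
    (∏ a : Fin h, (1 + X (Fin.castAdd h a) * X (Fin.natAdd h a)) : MvPolynomial (Fin (h + h)) ℂ) =
      ∑ S ∈ (univ : Finset (Fin h)).powerset, monomial
        (∑ a' ∈ S, (Finsupp.single (Fin.castAdd h a') 1 + Finsupp.single (Fin.natAdd h a') 1)) 1 := by
  rw [Finset.prod_one_add]
  refine Finset.sum_congr rfl fun S _ => ?_
  rw [monomial_sum_one]
  refine Finset.prod_congr rfl fun a _ => ?_
  rw [X, X, monomial_mul, mul_one]

/-- **Coefficients of the diagonal product state**: `coeff_{x^U y^W} ∏_a (1 + x_a y_a) = [U = W]`. -/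
theorem coeff_diagState (U W : Finset (Fin h)) :
    coeff (∑ a ∈ U, Finsupp.single (Fin.castAdd h a) 1 + ∑ c ∈ W, Finsupp.single (Fin.natAdd h c) 1)
      (∏ a : Fin h, (1 + X (Fin.castAdd h a) * X (Fin.natAdd h a)) : MvPolynomial (Fin (h + h)) ℂ) =
      if U = W then 1 else 0 := by
  rw [diagState_eq_sum_monomial, coeff_sum]
  simp_rw [coeff_monomial, diagExpo_eq_partitionExpo_iff]
  by_cases hUW : U = W
  · subst hUW
    rw [if_pos rfl, Finset.sum_eq_single U]
    · simp
    · intro S _ hS; rw [if_neg (fun h' => hS h'.1)]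
    · intro hU; exact absurd (Finset.mem_powerset.mpr (Finset.subset_univ U)) hU
  · rw [if_neg hUW]
    refine Finset.sum_eq_zero fun S _ => ?_
    rw [if_neg]
    rintro ⟨rfl, rfl⟩
    exact hUW rfl

/-- The diagonal product state lies in `SmallCircuits ℂ (h+h) 2` (`h ≥ 1`): degree `≤ 2h`, size `≤ 3h`. -/
theorem diagState_mem_smallCircuits (hh : 1 ≤ h) :
    (∏ a : Fin h, (1 + X (Fin.castAdd h a) * X (Fin.natAdd h a)) : MvPolynomial (Fin (h + h)) ℂ) ∈
      SmallCircuits ℂ (h + h) 2 := by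
  refine ⟨?_, ?_⟩
  · calc (∏ a : Fin h, (1 + X (Fin.castAdd h a) * X (Fin.natAdd h a)) :
          MvPolynomial (Fin (h + h)) ℂ).totalDegree
        ≤ ∑ a : Fin h, (1 + X (Fin.castAdd h a) * X (Fin.natAdd h a) :
            MvPolynomial (Fin (h + h)) ℂ).totalDegree := totalDegree_finsetProd _ _
      _ ≤ ∑ _a : Fin h, 2 := Finset.sum_le_sum fun a _ => by
          refine (totalDegree_add _ _).trans (max_le (by simp) ?_)
          refine (totalDegree_mul _ _).trans ?_
          rw [totalDegree_X, totalDegree_X]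
      _ = h + h := by simp; ring
  · have hfac : ∀ a : Fin h, complexity (1 + X (Fin.castAdd h a) * X (Fin.natAdd h a) :
        MvPolynomial (Fin (h + h)) ℂ) ≤ 2 := by
      intro a
      calc complexity (1 + X (Fin.castAdd h a) * X (Fin.natAdd h a) : MvPolynomial (Fin (h + h)) ℂ)
          ≤ complexity (1 : MvPolynomial (Fin (h + h)) ℂ) +
              complexity (X (Fin.castAdd h a) * X (Fin.natAdd h a) : MvPolynomial (Fin (h + h)) ℂ) + 1 :=
            complexity_add_le_holds _ _
        _ ≤ 0 + (complexity (X (Fin.castAdd h a) : MvPolynomial (Fin (h + h)) ℂ) +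
              complexity (X (Fin.natAdd h a) : MvPolynomial (Fin (h + h)) ℂ) + 1) + 1 := by
            gcongr
            · rw [← C_1]; exact (complexity_C_holds _).le
            · exact complexity_mul_le_holds _ _
        _ = 2 := by rw [complexity_X_holds, complexity_X_holds]
    calc complexity (∏ a : Fin h, (1 + X (Fin.castAdd h a) * X (Fin.natAdd h a)) :
          MvPolynomial (Fin (h + h)) ℂ)
        ≤ ∑ a : Fin h, complexity (1 + X (Fin.castAdd h a) * X (Fin.natAdd h a) :
            MvPolynomial (Fin (h + h)) ℂ) + (univ : Finset (Fin h)).card := complexity_finset_prod_le _ _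
      _ ≤ ∑ _a : Fin h, 2 + (univ : Finset (Fin h)).card := by gcongr with a _; exact hfac a
      _ = 3 * h := by simp; ring
      _ ≤ (h + h) ^ 2 := by nlinarith

/-- **Principal-type layouts are hit** (`b = 2`): if the columns are a rearrangement of the (distinct) rows,
`w j = u (κ j)`, the layout matrix of item 19717 at the diagonal product state is the permutation matrix of `κ`. -/
theorem partitionMinor_hit_of_principal (h : ℕ) (hh : 1 ≤ h) (r : ℕ) (u w : Fin r → Finset (Fin h))
    (hu : Function.Injective u) (κ : Equiv.Perm (Fin r)) (hκ : ∀ j, w j = u (κ j)) :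
    ∃ f ∈ SmallCircuits ℂ (h + h) 2,
      (Matrix.of fun i j : Fin r => MvPolynomial.coeff
        (∑ a ∈ u i, Finsupp.single (Fin.castAdd h a) 1 +
          ∑ c ∈ w j, Finsupp.single (Fin.natAdd h c) 1) f).det ≠ 0 := by
  refine ⟨∏ a : Fin h, (1 + X (Fin.castAdd h a) * X (Fin.natAdd h a)), diagState_mem_smallCircuits hh, ?_⟩
  have hmat : (Matrix.of fun i j : Fin r => MvPolynomial.coeff
        (∑ a ∈ u i, Finsupp.single (Fin.castAdd h a) 1 + ∑ c ∈ w j, Finsupp.single (Fin.natAdd h c) 1)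
        (∏ a : Fin h, (1 + X (Fin.castAdd h a) * X (Fin.natAdd h a)) : MvPolynomial (Fin (h + h)) ℂ)) =
      (1 : Matrix (Fin r) (Fin r) ℂ).submatrix id κ := by
    ext i j
    rw [Matrix.of_apply, coeff_diagState, Matrix.submatrix_apply, Matrix.one_apply, hκ j, id]
    simp only [hu.eq_iff]
  rw [hmat, Matrix.det_permute', Matrix.det_one, mul_one]
  exact Int.cast_ne_zero.mpr (Units.ne_zero _)

end

end Summit.ValiantsHypothesis.ValiantsHypothesis.Theorems.BarrierLever.ProductStateSums
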